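import Summits.QuantumFields.BalabanUV.Beta.HessKerDressedUnitsWall

/-!
# `BalabanUV.Beta.HessKerDressedStep` — the ONE-STEP (CONV-C) currency: `|𝒦^{(k+1)} − 𝒦^{(k)}| ≤ cθ^k e^{−δ|·|}` ⟹ the wall's
# all-scales binders, and the wall's ENDs with ONE-STEP data in any units (asymptotic lane asym1, gen 16, v1; CONSUMER-SIDE adapter for
# row G-an2-4 / (CONV-C))

HONEST FRAMING (cell contract, verbatim): «discharging `BetaPertH` makes Bałaban's UV stability UNCONDITIONAL — a real
constructive-QFT result; it is NOT the continuum limit and NOT the Clay problem.»  THIS MODULE is [folklore] real analysis (the geometric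
series between two levels, entry by entry, in the tree's weighted kernel classes) followed by the tree's ENDs BY NAME; it formalises NO
statement printed in Bałaban's papers, cites none as a hypothesis, mints no `Prop` fact, instantiates NO binder of the wall at a value
(RULING (R18-3); the colour weights `cE, cVH, cΛ`, the tables `W j`, their localisation data and the unit sequences `s_f, s_m` stay
UNIVERSALLY BOUND; no `UNITS` numeral is touched or asserted) and DISCHARGES NOTHING of it.  NOT summit progress.

ABSOLUTE RULE (cell, verbatim): «No internally-minted statement may enter as a cited fact. Every hypothesis is either
kernel-proved in this package or a verbatim quotation of a PUBLISHED theorem with page reference. The manuscript(s) under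
audit are NOT citable for their own disputed steps — they are the thing under adjudication; programme-internal
(2001/route/tribunal) claims are never citable.»  The data binders below (ONE-STEP (CONV-C) in some unit convention: `j`-uniform
pointwise bounds + CONSECUTIVE-LEVEL deviations with a rate) are HYPOTHESIS SHAPES with free constants, never asserted; nothing here says
that Bałaban's objects satisfy them in any units (located, NOT in print: O-asym1-1 = row G-an2-4 of `HOME/BINDER-OWNERS.md`).

PLACEMENT.  Cell result under the registered topic `Summits/QuantumFields/BalabanUV/Beta/` (β-lead (R34-2); ≤ 400 lines); imports the
sibling `HessKerDressedUnitsWall` (p195431) only.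

WHY THIS LEAF.  The (CONV-C) target of row G-an2-4 is typed (`BETA/AN2.md` §9, `BETA/GAN24-NAMES.md` §A) in ONE-STEP form —
`|𝒦^{(k+1)} − 𝒦^{(k)}|(y,y′) ≤ C₄θ^k e^{−δ₄|y−y′|}` together with `|𝒦^{(k)}|(y,y′) ≤ C₄e^{−δ₄|y−y′|}` — whereas the
wall-level ENDs of this lane (`HessKerDressedUnitsWall.d1Drift_JsBalOf_iff_of_cauchy_unit` and its companions; `HessKerDressedCauchy` §3 /
`HessKerDressedLimit` §3 in raw units) bind the ALL-SCALES («Cauchy between any two levels») form `∀ k j, Decays (K (k+j) − K k) (c θ^k) δ`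
(and its `LocStencil` / `VertexFamily₂` analogues).  The passage is the geometric series `Σ_{i<j} cθ^{k+i} ≤ (c/(1−θ))θ^k`, ENTRY BY ENTRY
with the weight `e^{−δ|x−y|₁}` (resp. the bi-localisation weight) carried along — asym2's scalar `RemainderConstAllScales.allScalesSeq_of_cauchyRate`
BY NAME.  So a supplier who proves the one-step form (in whichever leg units its estimates are uniform in) meets the wall's binders with the
constants `c_• / (1 − θ)`, SAME rates `δ_•`, SAME `θ`; conversely the all-scales form gives the one-step form at `j = 1` with the SAME
constant — the two supplier targets are interchangeable for `0 ≤ θ < 1`.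

CONTENT (all [folklore]; no `def`, no `Prop`; every constant explicit).
* §1 generic `MKer D F`: the scalar brick `abs_sub_le_of_step_weighted` (`|t(k+1) − t k| ≤ cθ^k w` ⟹ `|t(k+j) − t k| ≤ (c/(1−θ))θ^k w`);
  ONE-STEP ⟹ ALL-SCALES in `Decays` (`decays_allScales_of_step`), `BiLoc` (`biLoc_allScales_of_step`), `VertexFamily₂`
  (`vertexFamily₂_allScales_of_step`) and an1's `LocStencil` (`locStencil_allScales_of_step`); the converses at `j = 1`
  (`decays_step_of_allScales`, `locStencil_step_of_allScales`, `vertexFamily₂_step_of_allScales`); and ONE-STEP data ⟹ the CONSTRUCTED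
  LIMITS of `HessKerDressedLimit` §1 lie in the classes with the SAME uniform constant and are approached at rate `(c/(1−θ))θ^k`
  (`decays_limMKerOf_of_step`, `decays_sub_limMKerOf_of_step`, `locStencil_limStOf_of_step`, `locStencil_sub_limStOf_of_step`,
  `vertexFamily₂_limTabOf_of_step`, `vertexFamily₂_sub_limTabOf_of_step`).
* §2 `d = 3`, THE WALL'S FAMILY IN ANY UNITS WITH ONE-STEP DATA (`HessKerDressedUnitsWall` §3 BY NAME at the constants `c_•/(1−θ)`):
  `allScalesSeq_secondMoment_TbalOf_JsBalOf_step_unit` (explicit `κ`, the §3 one with `c_• ↦ c_•/(1−θ)`),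
  `limKernelOf_TbalOf_JsBalOf_apply_step_unit`, **`d1Drift_JsBalOf_iff_of_step_unit`** (THE WALL ⟺ the explicit identification at the
  constructed limits of the rescaled primitives, from ONE-STEP data, `0 ≤ θ < 1`), `d1Drift_JsBalOf_of_step_eq_unit` (the (⇐) direction).

UPSHOT FOR THE WALL.  Binder list for road A2 unchanged in CONTENT ({(CONV-C) data ; identification}); what is added is the SOCKET SHAPE a
one-step supplier (row G-an2-4) plugs into: three `j`-uniform bounds + three one-step deviation bounds on the rescaled primitives
`D_j K_j D_j`, `unitS_j S_j`, `unitW_j W_j` (any ONE convention of nonzero leg units common to the three rows), `0 < R < δ_K`, `R/2 < δ_S`,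
`R < δ_W`, `0 ≤ θ < 1`.  WHAT IS NOT HERE (located, NOT in print, NOT claimed): that Bałaban's primitives satisfy the one-step bounds in any
units (row G-an2-4: gan24-p1/p2/p3; Bałaban prints `η`-UNIFORM bounds, not scale-to-scale rates; printed precedents for OTHER models:
Gawędzki–Kupiainen 1981, King 1986 — `Literature/…/King1986/EffectiveLaplacianRate`); the identification (O-asym1-7, row D1); any numeric
value of `C, c_•, δ_•, θ, R, s_f, s_m`; `betaPertH_holds`.  NOT continuum, NOT Clay.
-/

open Finset Filter Topology
open scoped BigOperators
open Literature.MathematicalPhysics.QuantumFieldTheory.Balaban1983to89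
open Literature.MathematicalPhysics.QuantumFieldTheory.Balaban1983to89.Beta
open B12Sec2to5 (betaPrime510)
open ExpKernelCalculus (MKer Decays BiLoc VertexFamily₂ hessKer Zl)
open LimitRate (limKernelOf)
open HessKerSchur (lipW)
open RemainderConstAllScales (AllScalesSeq allScalesSeq_of_cauchyRate)
open RateCertificate (GeomRate CauchyRate)
open OneStepResolventKernel (Fib LocStencil JetData)
open OneStepKernelFamily (KInvStep TbalOf D1Drift)
open AxialDressing (axDressK cAx cN' axVertexOfK)
open BalabanStepJetsSucc (JsBal0Of JsBalOf)
open HessKerDressedLimit (limMKerOf limStOf limTabOf mker_sub_apply decays_limMKerOf decays_sub_limMKerOf locStencil_limStOf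
  locStencil_sub_limStOf vertexFamily₂_limTabOf vertexFamily₂_sub_limTabOf)
open Summit.QuantumFields.BalabanUV.Beta.HessKerDressedUnits
open Summit.QuantumFields.BalabanUV.Beta.HessKerDressedUnitsWall

namespace Summit.QuantumFields.BalabanUV.Beta.HessKerDressedStep

/-! ## §1 ONE-STEP ⟹ ALL-SCALES in the weighted kernel classes (generic `D`, `F`); the constructed limits from one-step data -/

section Scalar

/-- [folklore] **THE SCALAR BRICK**: a weighted ONE-STEP bound `|t(k+1) − t k| ≤ cθ^k w` with `0 ≤ θ < 1` gives the weighted ALL-SCALES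
bound `|t(k+j) − t k| ≤ (c/(1−θ))θ^k w` (geometric series; asym2's `allScalesSeq_of_cauchyRate` at the constant `c·w`). -/
theorem abs_sub_le_of_step_weighted {t : ℕ → ℝ} {c w θ : ℝ} (h : ∀ k, |t (k + 1) - t k| ≤ c * θ ^ k * w) (hθ0 : 0 ≤ θ)
    (hθ1 : θ < 1) (k j : ℕ) : |t (k + j) - t k| ≤ c / (1 - θ) * θ ^ k * w := by
  have hc : CauchyRate t (c * w) θ := fun k => (h k).trans_eq (by ring)
  exact ((allScalesSeq_of_cauchyRate hc hθ0 hθ1) k j).trans_eq (by ring)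

end Scalar

section Lim

variable {D : ℕ} {F : Type*}

/-- [folklore] **ONE-STEP ⟹ ALL-SCALES IN `Decays`**: `Decays (K(k+1) − K k) (cθ^k) δ` for all `k`, `0 ≤ θ < 1` ⟹
`Decays (K(k+j) − K k) ((c/(1−θ))θ^k) δ` for all `k, j` — SAME rate `δ`, SAME `θ`. -/
theorem decays_allScales_of_step {K : ℕ → MKer D F} {c δ θ : ℝ} (h : ∀ k, Decays (K (k + 1) - K k) (c * θ ^ k) δ) (hθ0 : 0 ≤ θ)
    (hθ1 : θ < 1) (k j : ℕ) : Decays (K (k + j) - K k) (c / (1 - θ) * θ ^ k) δ := fun x y a b => by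
  rw [mker_sub_apply]
  exact abs_sub_le_of_step_weighted (t := fun j => K j x y a b) (fun k => by simpa only [mker_sub_apply] using h k x y a b) hθ0 hθ1 k j

/-- [folklore] The converse, SAME constant: all-scales deviations give the one-step ones (`j = 1`). -/
theorem decays_step_of_allScales {K : ℕ → MKer D F} {c δ θ : ℝ} (h : ∀ k j, Decays (K (k + j) - K k) (c * θ ^ k) δ) (k : ℕ) :
    Decays (K (k + 1) - K k) (c * θ ^ k) δ :=
  h k 1

/-- [folklore] **ONE-STEP ⟹ ALL-SCALES IN `BiLoc`**. -/
theorem biLoc_allScales_of_step {T : ℕ → MKer D F} {p q : Fin D → ℤ} {c δ θ : ℝ} (h : ∀ k, BiLoc (T (k + 1) - T k) p q (c * θ ^ k) δ)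
    (hθ0 : 0 ≤ θ) (hθ1 : θ < 1) (k j : ℕ) : BiLoc (T (k + j) - T k) p q (c / (1 - θ) * θ ^ k) δ := fun x y a b => by
  rw [mker_sub_apply]
  exact abs_sub_le_of_step_weighted (t := fun j => T j x y a b) (fun k => by simpa only [mker_sub_apply] using h k x y a b) hθ0 hθ1 k j

/-- [folklore] **ONE-STEP ⟹ ALL-SCALES IN `VertexFamily₂`**. -/
theorem vertexFamily₂_allScales_of_step {W : ℕ → Fin D → (Fin D → ℤ) → Fin D → (Fin D → ℤ) → MKer D F} {N : ℕ} {c δ θ : ℝ}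
    (h : ∀ k, VertexFamily₂ (W (k + 1) - W k) N (c * θ ^ k) δ) (hθ0 : 0 ≤ θ) (hθ1 : θ < 1) (k j : ℕ) :
    VertexFamily₂ (W (k + j) - W k) N (c / (1 - θ) * θ ^ k) δ := fun μ y ν y' => by
  simpa only [Pi.sub_apply] using biLoc_allScales_of_step (T := fun j => W j μ y ν y')
    (fun k => by simpa only [Pi.sub_apply] using h k μ y ν y') hθ0 hθ1 k j

/-- [folklore] The converse in `VertexFamily₂`, SAME constant (`j = 1`). -/
theorem vertexFamily₂_step_of_allScales {W : ℕ → Fin D → (Fin D → ℤ) → Fin D → (Fin D → ℤ) → MKer D F} {N : ℕ} {c δ θ : ℝ}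
    (h : ∀ k j, VertexFamily₂ (W (k + j) - W k) N (c * θ ^ k) δ) (k : ℕ) : VertexFamily₂ (W (k + 1) - W k) N (c * θ ^ k) δ :=
  h k 1

/-- [folklore] ONE-STEP `Decays` data ⟹ the `j`-uniform bound passes to the CONSTRUCTED LIMIT `limMKerOf K`, SAME constant and rate. -/
theorem decays_limMKerOf_of_step {K : ℕ → MKer D F} {C c δ δ' θ : ℝ} (hK : ∀ j, Decays (K j) C δ')
    (h : ∀ k, Decays (K (k + 1) - K k) (c * θ ^ k) δ) (hθ0 : 0 ≤ θ) (hθ1 : θ < 1) : Decays (limMKerOf K) C δ' :=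
  decays_limMKerOf hK (decays_allScales_of_step h hθ0 hθ1) hθ1

/-- [folklore] ONE-STEP `Decays` data ⟹ RATE TO THE CONSTRUCTED LIMIT: `Decays (K k − limMKerOf K) ((c/(1−θ))θ^k) δ`. -/
theorem decays_sub_limMKerOf_of_step {K : ℕ → MKer D F} {c δ θ : ℝ} (h : ∀ k, Decays (K (k + 1) - K k) (c * θ ^ k) δ) (hθ0 : 0 ≤ θ)
    (hθ1 : θ < 1) (k : ℕ) : Decays (K k - limMKerOf K) (c / (1 - θ) * θ ^ k) δ :=
  decays_sub_limMKerOf (decays_allScales_of_step h hθ0 hθ1) hθ1 k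

/-- [folklore] ONE-STEP `VertexFamily₂` data ⟹ the uniform bound passes to the constructed limit tables `limTabOf W`. -/
theorem vertexFamily₂_limTabOf_of_step {W : ℕ → Fin D → (Fin D → ℤ) → Fin D → (Fin D → ℤ) → MKer D F} {N : ℕ} {Cw c δ δ' θ : ℝ}
    (hW : ∀ j, VertexFamily₂ (W j) N Cw δ') (h : ∀ k, VertexFamily₂ (W (k + 1) - W k) N (c * θ ^ k) δ) (hθ0 : 0 ≤ θ) (hθ1 : θ < 1) :
    VertexFamily₂ (limTabOf W) N Cw δ' :=
  vertexFamily₂_limTabOf hW (vertexFamily₂_allScales_of_step h hθ0 hθ1) hθ1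

/-- [folklore] ONE-STEP `VertexFamily₂` data ⟹ rate to the constructed limit tables, constant `c/(1−θ)`. -/
theorem vertexFamily₂_sub_limTabOf_of_step {W : ℕ → Fin D → (Fin D → ℤ) → Fin D → (Fin D → ℤ) → MKer D F} {N : ℕ} {c δ θ : ℝ}
    (h : ∀ k, VertexFamily₂ (W (k + 1) - W k) N (c * θ ^ k) δ) (hθ0 : 0 ≤ θ) (hθ1 : θ < 1) (k : ℕ) :
    VertexFamily₂ (W k - limTabOf W) N (c / (1 - θ) * θ ^ k) δ :=
  vertexFamily₂_sub_limTabOf (vertexFamily₂_allScales_of_step h hθ0 hθ1) hθ1 k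

end Lim

section Stencil

variable {d : ℕ}

/-- [folklore] **ONE-STEP ⟹ ALL-SCALES IN `LocStencil`** (an1's stencil class on `MKer (d+1) (Fib d)`). -/
theorem locStencil_allScales_of_step {S : ℕ → Fin (d + 1) → (Fin (d + 1) → ℤ) → MKer (d + 1) (Fib d)} {c δ θ : ℝ}
    (h : ∀ k, LocStencil (S (k + 1) - S k) (c * θ ^ k) δ) (hθ0 : 0 ≤ θ) (hθ1 : θ < 1) (k j : ℕ) :
    LocStencil (S (k + j) - S k) (c / (1 - θ) * θ ^ k) δ := fun κ' u => by
  simpa only [Pi.sub_apply] using biLoc_allScales_of_step (T := fun j => S j κ' u)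
    (fun k => by simpa only [Pi.sub_apply] using h k κ' u) hθ0 hθ1 k j

/-- [folklore] The converse in `LocStencil`, SAME constant (`j = 1`). -/
theorem locStencil_step_of_allScales {S : ℕ → Fin (d + 1) → (Fin (d + 1) → ℤ) → MKer (d + 1) (Fib d)} {c δ θ : ℝ}
    (h : ∀ k j, LocStencil (S (k + j) - S k) (c * θ ^ k) δ) (k : ℕ) : LocStencil (S (k + 1) - S k) (c * θ ^ k) δ :=
  h k 1

/-- [folklore] ONE-STEP `LocStencil` data ⟹ the uniform bound passes to the constructed limit stencils `limStOf S`. -/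
theorem locStencil_limStOf_of_step {S : ℕ → Fin (d + 1) → (Fin (d + 1) → ℤ) → MKer (d + 1) (Fib d)} {Cs c δ δ' θ : ℝ}
    (hS : ∀ j, LocStencil (S j) Cs δ') (h : ∀ k, LocStencil (S (k + 1) - S k) (c * θ ^ k) δ) (hθ0 : 0 ≤ θ) (hθ1 : θ < 1) :
    LocStencil (limStOf S) Cs δ' :=
  locStencil_limStOf hS (locStencil_allScales_of_step h hθ0 hθ1) hθ1

/-- [folklore] ONE-STEP `LocStencil` data ⟹ rate to the constructed limit stencils, constant `c/(1−θ)`. -/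
theorem locStencil_sub_limStOf_of_step {S : ℕ → Fin (d + 1) → (Fin (d + 1) → ℤ) → MKer (d + 1) (Fib d)} {c δ θ : ℝ}
    (h : ∀ k, LocStencil (S (k + 1) - S k) (c * θ ^ k) δ) (hθ0 : 0 ≤ θ) (hθ1 : θ < 1) (k : ℕ) :
    LocStencil (S k - limStOf S) (c / (1 - θ) * θ ^ k) δ :=
  locStencil_sub_limStOf (locStencil_allScales_of_step h hθ0 hθ1) hθ1 k

end Stencil

/-! ## §2 Dimension four: THE WALL'S ENDs IN ANY UNITS FROM ONE-STEP DATA (`HessKerDressedUnitsWall` §3 BY NAME at the constants `c_•/(1−θ)`) -/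

section EndStep

variable {Lc : ℕ} [NeZero Lc] (hLc : 1 ≤ Lc) (cE cVH cΛ : ℝ)
  (W : ℕ → Fin (3 + 1) → (Fin (3 + 1) → ℤ) → Fin (3 + 1) → (Fin (3 + 1) → ℤ) → MKer (3 + 1) (Fib 3))
  (Cw' δw : ℕ → ℝ) (hδw : ∀ j, 0 < δw j) (hW' : ∀ j, VertexFamily₂ (W j) Lc (Cw' j) (δw j))
  (sf sm : ℕ → ℝ)
  {R C cK δK Cs cS δS Cw cW δW θ : ℝ}

/-- [folklore] **THE END INSTANCE OVER `JsBalOf` IN ANY UNITS FROM ONE-STEP DATA — SCALAR ALL-SCALES FORM**: `j`-uniform pointwise bounds and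
ONE-STEP deviations with rate `θ` (`0 ≤ θ < 1`) of the RESCALED primitives give
`AllScalesSeq (j ↦ secondMoment (TbalOf Lc (JsBalOf …) j) μ ν) κ θ` with the EXPLICIT `κ` of
`HessKerDressedUnitsWall.allScalesSeq_secondMoment_TbalOf_JsBalOf_unit` at `c_K, c_S, c_W ↦ c_K/(1−θ), c_S/(1−θ), c_W/(1−θ)`. -/
theorem allScalesSeq_secondMoment_TbalOf_JsBalOf_step_unit (hsf : ∀ j, sf j ≠ 0) (hsm : ∀ j, sm j ≠ 0)
    (hK : ∀ j, Decays (unitK (sf j) (sm j) (KInvStep (d := 3) Lc j)) C δK)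
    (hKstep : ∀ k, Decays (unitK (sf (k + 1)) (sm (k + 1)) (KInvStep (d := 3) Lc (k + 1)) -
      unitK (sf k) (sm k) (KInvStep (d := 3) Lc k)) (cK * θ ^ k) δK)
    (hS : ∀ j, LocStencil (unitS (sf j) (sm j) (JsBal0Of hLc cE cVH cΛ W Cw' δw hδw hW' j).S) Cs δS)
    (hSstep : ∀ k, LocStencil (unitS (sf (k + 1)) (sm (k + 1)) (JsBal0Of hLc cE cVH cΛ W Cw' δw hδw hW' (k + 1)).S -
      unitS (sf k) (sm k) (JsBal0Of hLc cE cVH cΛ W Cw' δw hδw hW' k).S) (cS * θ ^ k) δS)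
    (hW : ∀ j, VertexFamily₂ (unitW (sf j) (sm j) (W j)) Lc Cw δW)
    (hWstep : ∀ k, VertexFamily₂ (unitW (sf (k + 1)) (sm (k + 1)) (W (k + 1)) - unitW (sf k) (sm k) (W k)) Lc (cW * θ ^ k) δW)
    (hR : 0 < R) (hRK : R < δK) (hRS : R / 2 < δS) (hRW : R < δW) (hθ0 : 0 ≤ θ) (hθ1 : θ < 1) (μ ν : Fin 4) :
    AllScalesSeq (fun j => B12Beta.secondMoment (TbalOf Lc (JsBalOf hLc cE cVH cΛ W Cw' δw hδw hW') j) μ ν)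
      (betaPrime510 4
        (lipW ((Fintype.card (Fib 3) : ℝ) * (cAx 3 Lc δK * (cAx 3 Lc δK * C)) * Zl 4 (δK - R))
          ((Fintype.card (Fib 3) : ℝ) * (cAx 3 Lc δK * (cAx 3 Lc δK * C)) * Zl 4 (δK - R))
          ((Fintype.card (Fib 3) : ℝ) * C * Zl 4 (δK - R) * ((Fintype.card (Fib 3) : ℝ) ^ 2 * (cN' 3 Lc δS * Cs) * Zl 4 (δS - R / 2) ^ 2))
          ((Fintype.card (Fib 3) : ℝ) * C * Zl 4 (δK - R) * ((Fintype.card (Fib 3) : ℝ) ^ 2 * (cN' 3 Lc δS * Cs) * Zl 4 (δS - R / 2) ^ 2))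
          ((Fintype.card (Fib 3) : ℝ) ^ 2 * Cw * Zl 4 (δW - R) ^ 2)
          ((Fintype.card (Fib 3) : ℝ) * (cAx 3 Lc δK * (cAx 3 Lc δK * (cK / (1 - θ)))) * Zl 4 (δK - R))
          ((Fintype.card (Fib 3) : ℝ) * (cK / (1 - θ)) * Zl 4 (δK - R) *
              ((Fintype.card (Fib 3) : ℝ) ^ 2 * (cN' 3 Lc δS * Cs) * Zl 4 (δS - R / 2) ^ 2) +
            (Fintype.card (Fib 3) : ℝ) * C * Zl 4 (δK - R) *
              ((Fintype.card (Fib 3) : ℝ) ^ 2 * (cN' 3 Lc δS * (cS / (1 - θ))) * Zl 4 (δS - R / 2) ^ 2))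
          ((Fintype.card (Fib 3) : ℝ) ^ 2 * (cW / (1 - θ)) * Zl 4 (δW - R) ^ 2))
        (R * Lc)) θ :=
  allScalesSeq_secondMoment_TbalOf_JsBalOf_unit hLc cE cVH cΛ W Cw' δw hδw hW' sf sm hsf hsm hK
    (decays_allScales_of_step (K := fun j => unitK (sf j) (sm j) (KInvStep (d := 3) Lc j)) hKstep hθ0 hθ1) hS
    (locStencil_allScales_of_step (S := fun j => unitS (sf j) (sm j) (JsBal0Of hLc cE cVH cΛ W Cw' δw hδw hW' j).S) hSstep hθ0 hθ1) hW
    (vertexFamily₂_allScales_of_step (W := fun j => unitW (sf j) (sm j) (W j)) hWstep hθ0 hθ1) hR hRK hRS hRW μ ν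

/-- [folklore] **THE TELESCOPED LIMIT KERNEL OF THE WALL'S FAMILY FROM ONE-STEP DATA IN ANY UNITS**: entrywise in the `(μ,ν)` component,
`limKernelOf (TbalOf Lc (JsBalOf …)) μ ν x = hessKer (axDressK Lc K∞) (axVertexOfK K∞ Lc S∞) W∞ μ ν x` at the CONSTRUCTED limits of the
RESCALED families (`HessKerDressedUnitsWall.limKernelOf_TbalOf_JsBalOf_apply_unit` BY NAME). -/
theorem limKernelOf_TbalOf_JsBalOf_apply_step_unit (hsf : ∀ j, sf j ≠ 0) (hsm : ∀ j, sm j ≠ 0)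
    (hK : ∀ j, Decays (unitK (sf j) (sm j) (KInvStep (d := 3) Lc j)) C δK)
    (hKstep : ∀ k, Decays (unitK (sf (k + 1)) (sm (k + 1)) (KInvStep (d := 3) Lc (k + 1)) -
      unitK (sf k) (sm k) (KInvStep (d := 3) Lc k)) (cK * θ ^ k) δK)
    (hS : ∀ j, LocStencil (unitS (sf j) (sm j) (JsBal0Of hLc cE cVH cΛ W Cw' δw hδw hW' j).S) Cs δS)
    (hSstep : ∀ k, LocStencil (unitS (sf (k + 1)) (sm (k + 1)) (JsBal0Of hLc cE cVH cΛ W Cw' δw hδw hW' (k + 1)).S -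
      unitS (sf k) (sm k) (JsBal0Of hLc cE cVH cΛ W Cw' δw hδw hW' k).S) (cS * θ ^ k) δS)
    (hW : ∀ j, VertexFamily₂ (unitW (sf j) (sm j) (W j)) Lc Cw δW)
    (hWstep : ∀ k, VertexFamily₂ (unitW (sf (k + 1)) (sm (k + 1)) (W (k + 1)) - unitW (sf k) (sm k) (W k)) Lc (cW * θ ^ k) δW)
    (hR : 0 < R) (hRK : R < δK) (hRS : R / 2 < δS) (hRW : R < δW) (hθ0 : 0 ≤ θ) (hθ1 : θ < 1) (μ ν : Fin 4) (x : Fin 4 → ℤ) :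
    limKernelOf (TbalOf Lc (JsBalOf hLc cE cVH cΛ W Cw' δw hδw hW')) μ ν x =
      hessKer (axDressK Lc (limMKerOf fun j => unitK (sf j) (sm j) (KInvStep (d := 3) Lc j)))
        (axVertexOfK (limMKerOf fun j => unitK (sf j) (sm j) (KInvStep (d := 3) Lc j)) Lc
          (limStOf fun j => unitS (sf j) (sm j) (JsBal0Of hLc cE cVH cΛ W Cw' δw hδw hW' j).S))
        (limTabOf fun j => unitW (sf j) (sm j) (W j)) μ ν x :=
  limKernelOf_TbalOf_JsBalOf_apply_unit hLc cE cVH cΛ W Cw' δw hδw hW' sf sm hsf hsm hK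
    (decays_allScales_of_step (K := fun j => unitK (sf j) (sm j) (KInvStep (d := 3) Lc j)) hKstep hθ0 hθ1) hS
    (locStencil_allScales_of_step (S := fun j => unitS (sf j) (sm j) (JsBal0Of hLc cE cVH cΛ W Cw' δw hδw hW' j).S) hSstep hθ0 hθ1) hW
    (vertexFamily₂_allScales_of_step (W := fun j => unitW (sf j) (sm j) (W j)) hWstep hθ0 hθ1) hR hRK hRS hRW hθ0 hθ1 μ ν x

/-- [folklore] **THE WALL ⟺ THE EXPLICIT IDENTIFICATION AT THE CONSTRUCTED LIMITS, ONE-STEP CURRENCY, ANY UNITS**: `j`-uniform bounds and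
ONE-STEP (consecutive-level) deviations with rate `θ`, `0 ≤ θ < 1`, of the RESCALED primitives `D_j K_j D_j`, `unitS_j S_j`, `unitW_j W_j`
(any ONE convention of nonzero leg units `s_f, s_m` common to the three rows; nothing else added) ⟹
`D1Drift Lc (JsBalOf …) N μ ν ↔ secondMoment (hessKer (axDressK Lc K∞) (axVertexOfK K∞ Lc S∞) W∞) μ ν = stepBal N Lc` at the constructed
limits of the rescaled families (`HessKerDressedUnitsWall.d1Drift_JsBalOf_iff_of_cauchy_unit` BY NAME + §1).  THE SOCKET a one-step
(CONV-C) supplier plugs into.  Road A2's second half; NOT proved here. -/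
theorem d1Drift_JsBalOf_iff_of_step_unit (hsf : ∀ j, sf j ≠ 0) (hsm : ∀ j, sm j ≠ 0)
    (hK : ∀ j, Decays (unitK (sf j) (sm j) (KInvStep (d := 3) Lc j)) C δK)
    (hKstep : ∀ k, Decays (unitK (sf (k + 1)) (sm (k + 1)) (KInvStep (d := 3) Lc (k + 1)) -
      unitK (sf k) (sm k) (KInvStep (d := 3) Lc k)) (cK * θ ^ k) δK)
    (hS : ∀ j, LocStencil (unitS (sf j) (sm j) (JsBal0Of hLc cE cVH cΛ W Cw' δw hδw hW' j).S) Cs δS)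
    (hSstep : ∀ k, LocStencil (unitS (sf (k + 1)) (sm (k + 1)) (JsBal0Of hLc cE cVH cΛ W Cw' δw hδw hW' (k + 1)).S -
      unitS (sf k) (sm k) (JsBal0Of hLc cE cVH cΛ W Cw' δw hδw hW' k).S) (cS * θ ^ k) δS)
    (hW : ∀ j, VertexFamily₂ (unitW (sf j) (sm j) (W j)) Lc Cw δW)
    (hWstep : ∀ k, VertexFamily₂ (unitW (sf (k + 1)) (sm (k + 1)) (W (k + 1)) - unitW (sf k) (sm k) (W k)) Lc (cW * θ ^ k) δW)
    (hR : 0 < R) (hRK : R < δK) (hRS : R / 2 < δS) (hRW : R < δW) (hθ0 : 0 ≤ θ) (hθ1 : θ < 1) (μ ν : Fin 4) (N : ℝ) :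
    D1Drift Lc (JsBalOf hLc cE cVH cΛ W Cw' δw hδw hW') N μ ν ↔
      B12Beta.secondMoment (hessKer (axDressK Lc (limMKerOf fun j => unitK (sf j) (sm j) (KInvStep (d := 3) Lc j)))
        (axVertexOfK (limMKerOf fun j => unitK (sf j) (sm j) (KInvStep (d := 3) Lc j)) Lc
          (limStOf fun j => unitS (sf j) (sm j) (JsBal0Of hLc cE cVH cΛ W Cw' δw hδw hW' j).S))
        (limTabOf fun j => unitW (sf j) (sm j) (W j))) μ ν = B12Normalization.stepBal N Lc :=
  d1Drift_JsBalOf_iff_of_cauchy_unit hLc cE cVH cΛ W Cw' δw hδw hW' sf sm hsf hsm hK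
    (decays_allScales_of_step (K := fun j => unitK (sf j) (sm j) (KInvStep (d := 3) Lc j)) hKstep hθ0 hθ1) hS
    (locStencil_allScales_of_step (S := fun j => unitS (sf j) (sm j) (JsBal0Of hLc cE cVH cΛ W Cw' δw hδw hW' j).S) hSstep hθ0 hθ1) hW
    (vertexFamily₂_allScales_of_step (W := fun j => unitW (sf j) (sm j) (W j)) hWstep hθ0 hθ1) hR hRK hRS hRW hθ0 hθ1 μ ν N

/-- [folklore] **THE WALL FROM ONE-STEP (CONV-C) DATA IN ANY UNITS + THE EXPLICIT IDENTIFICATION AT THE CONSTRUCTED LIMITS** (the (⇐) direction). -/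
theorem d1Drift_JsBalOf_of_step_eq_unit (hsf : ∀ j, sf j ≠ 0) (hsm : ∀ j, sm j ≠ 0)
    (hK : ∀ j, Decays (unitK (sf j) (sm j) (KInvStep (d := 3) Lc j)) C δK)
    (hKstep : ∀ k, Decays (unitK (sf (k + 1)) (sm (k + 1)) (KInvStep (d := 3) Lc (k + 1)) -
      unitK (sf k) (sm k) (KInvStep (d := 3) Lc k)) (cK * θ ^ k) δK)
    (hS : ∀ j, LocStencil (unitS (sf j) (sm j) (JsBal0Of hLc cE cVH cΛ W Cw' δw hδw hW' j).S) Cs δS)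
    (hSstep : ∀ k, LocStencil (unitS (sf (k + 1)) (sm (k + 1)) (JsBal0Of hLc cE cVH cΛ W Cw' δw hδw hW' (k + 1)).S -
      unitS (sf k) (sm k) (JsBal0Of hLc cE cVH cΛ W Cw' δw hδw hW' k).S) (cS * θ ^ k) δS)
    (hW : ∀ j, VertexFamily₂ (unitW (sf j) (sm j) (W j)) Lc Cw δW)
    (hWstep : ∀ k, VertexFamily₂ (unitW (sf (k + 1)) (sm (k + 1)) (W (k + 1)) - unitW (sf k) (sm k) (W k)) Lc (cW * θ ^ k) δW)
    (hR : 0 < R) (hRK : R < δK) (hRS : R / 2 < δS) (hRW : R < δW) (hθ0 : 0 ≤ θ) (hθ1 : θ < 1) (μ ν : Fin 4) {N : ℝ}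
    (hident : B12Beta.secondMoment (hessKer (axDressK Lc (limMKerOf fun j => unitK (sf j) (sm j) (KInvStep (d := 3) Lc j)))
        (axVertexOfK (limMKerOf fun j => unitK (sf j) (sm j) (KInvStep (d := 3) Lc j)) Lc
          (limStOf fun j => unitS (sf j) (sm j) (JsBal0Of hLc cE cVH cΛ W Cw' δw hδw hW' j).S))
        (limTabOf fun j => unitW (sf j) (sm j) (W j))) μ ν = B12Normalization.stepBal N Lc) :
    D1Drift Lc (JsBalOf hLc cE cVH cΛ W Cw' δw hδw hW') N μ ν :=
  (d1Drift_JsBalOf_iff_of_step_unit hLc cE cVH cΛ W Cw' δw hδw hW' sf sm hsf hsm hK hKstep hS hSstep hW hWstep hR hRK hRS hRW hθ0 hθ1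
    μ ν N).2 hident

end EndStep

end Summit.QuantumFields.BalabanUV.Beta.HessKerDressedStep
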